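import Summits.CriticalPhenomena.PercolationContinuityZ3.Theorems.PercNearOneGluingNoHeavyLowerTailKnQuestion8AntitheticStalkSplit
import HarnessLib

/-!
# `NoHeavyLowerTail` (crux stmt-CriticalPhenomena-4575), antithetic vdBHK programme: HAT NEUTRALITY of the rearrangement inequality (R),
# kernel-complete at the colouring level (THEOREM HAT of FINDING-STALK-g54.md §3, both directions, for every finite poset)

Support file (seat `prim-ineq-gen-7` gen 55; `--supports stmt-CriticalPhenomena-4575`).  No `sorry`, no definitions.
Memo: run/shared/lean/prim/prim-ineq-gen-7/FINDING-STALK-g54.md §3 (HAT), FINDING-TWIN-g55.md §3 (this file).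

SETTING (hypothesis style, as in `AntitheticColouringOrder`, `AntitheticCrownObstruction`).  `E` is the (finite) ground set of the rooted poset
`Q ∪ₐ wedge` (the wedge `c′ < x′ > a` included; here `c = c′`, `x = x′`), `down e` the strict down-sets, colourings `s : E → Bool` (`true` = red), and
`leT` is the programme's explicit colouring order `κ(t) ⊆ κ(s) ∧ κ(s̄) ⊆ κ(t̄) ∧ (s ∖ t ⊆ κ(s) ∩ κ(t̄))` (`hleT`; red interior `κ(s) = {e : e and ↓°e red}`),
i.e. `T = TQ = Ω_{Q ∪ₐ wedge}`.  The wedge flip `ι′` complements every colour when `c′, x′` are equicoloured and flips only `c′, x′` otherwise (`hι`).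
The HAT: a new maximal element `z` (= `none : Option E`) covering exactly one atom `u` of `Q` (`hu : ↓°u = ∅`, `u ∉ {c′, x′}`); the colourings of
`Q + z ∪ₐ wedge` are `t : Option E → Bool`, their strict down-sets are `↓°z = {u}` (`hdZn`) and `↓°e` unchanged (`hdZs`), `leZ` is the same explicit
order (`hleZ`) and `κ` the same flip rule (`hκ`) — so `Z = TQ′` for `Q′ = Q + hat(u)`.  The rearrangement functional of a pair of finite sets is
`R(𝐀,𝐁) = #(𝐀 ∩ 𝐁) − #{p ∈ 𝐀 : flip p ∈ 𝐁}` and (R) says `R ≥ 0` on all pairs of up-sets.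
* `AntitheticHat.diag_iff`, `AntitheticHat.off_iff` — LEMMA A/D for hats: on the DIAGONAL `{z ≡ u}` and on the ANTIDIAGONAL `{z ≢ u}` the order of
  `Z` is the order of `T` (forgetting `z` is an order isomorphism of either half onto `TQ`).
* `AntitheticHat.hat_neutrality` — **(R)(Q,a) ⟹ (R)(Q + hat(u), a)**: `R_Z ≥ 0` on all pairs of `leZ`-up-sets, from `R_T ≥ 0` on all pairs of
  `leT`-up-sets (diagonal decomposition `AntitheticStalkSplit.R_split` + the two isomorphisms).
* `AntitheticHat.hat_lift` — the converse bookkeeping: for `leT`-up-sets `𝐀, 𝐁` the preimages under `t ↦ t ∘ some` are `leZ`-up-sets and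
  `R_Z(π⁻¹𝐀, π⁻¹𝐁) = 2·R_T(𝐀,𝐁)`; hence failures persist with DOUBLED deficit and `(R)(Q + hat(u), a) ⟺ (R)(Q, a)` (memo §3c: `min R_Z = 2·min R_T`).
No partial-order axioms on `down` are used: the statements hold for arbitrary `down` with `↓°u = ∅`.
-/

namespace Summit.CriticalPhenomena.PercolationContinuityZ3.Theorems

open Finset

namespace AntitheticHat

variable {E : Type*}

/-- Membership transport: a bounded quantifier over the hat's copy `↓°(some e) = some '' ↓°e`. [this work] -/
theorem forall_downZ_some (down : E → Finset E) (downZ : Option E → Finset (Option E))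
    (hdZs : ∀ e o, o ∈ downZ (some e) ↔ ∃ d ∈ down e, o = some d) (P : Option E → Prop) (e : E) :
    (∀ o ∈ downZ (some e), P o) ↔ (∀ d ∈ down e, P (some d)) := by
  constructor
  · intro h d hd
    exact h (some d) ((hdZs e (some d)).2 ⟨d, hd, rfl⟩)
  · intro h o ho
    obtain ⟨d, hd, rfl⟩ := (hdZs e o).1 ho
    exact h d hd

/-- Membership transport: a bounded quantifier over `↓°z = {u}`. [this work] -/
theorem forall_downZ_none (downZ : Option E → Finset (Option E)) (u : E)
    (hdZn : ∀ o, o ∈ downZ none ↔ o = some u) (P : Option E → Prop) :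
    (∀ o ∈ downZ none, P o) ↔ P (some u) := by
  constructor
  · intro h; exact h (some u) ((hdZn (some u)).2 rfl)
  · intro h o ho; rw [(hdZn o).1 ho]; exact h

/-- **LEMMA A/D (diagonal).**  On colourings of `Q + hat(u)` with `z` coloured like `u`, the explicit colouring order is the order of the restrictions
to `Q` (forgetting `z` is an order isomorphism of the diagonal onto `TQ`). [this work] -/
theorem diag_iff (down : E → Finset E) (u : E) (hu : ∀ d, d ∉ down u)
    (downZ : Option E → Finset (Option E)) (hdZn : ∀ o, o ∈ downZ none ↔ o = some u)
    (hdZs : ∀ e o, o ∈ downZ (some e) ↔ ∃ d ∈ down e, o = some d)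
    (leT : (E → Bool) → (E → Bool) → Prop)
    (hleT : ∀ s t, leT s t ↔
      ((∀ e, (t e = true ∧ ∀ d ∈ down e, t d = true) → (s e = true ∧ ∀ d ∈ down e, s d = true)) ∧
       (∀ e, (s e = false ∧ ∀ d ∈ down e, s d = false) → (t e = false ∧ ∀ d ∈ down e, t d = false)) ∧
       (∀ e, s e = true → t e = false → ((∀ d ∈ down e, s d = true) ∧ (∀ d ∈ down e, t d = false)))))
    (leZ : (Option E → Bool) → (Option E → Bool) → Prop)
    (hleZ : ∀ s t, leZ s t ↔
      ((∀ o, (t o = true ∧ ∀ d ∈ downZ o, t d = true) → (s o = true ∧ ∀ d ∈ downZ o, s d = true)) ∧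
       (∀ o, (s o = false ∧ ∀ d ∈ downZ o, s d = false) → (t o = false ∧ ∀ d ∈ downZ o, t d = false)) ∧
       (∀ o, s o = true → t o = false → ((∀ d ∈ downZ o, s d = true) ∧ (∀ d ∈ downZ o, t d = false)))))
    (s s' : E → Bool) (t t' : Option E → Bool) (hts : ∀ e, t (some e) = s e) (hts' : ∀ e, t' (some e) = s' e)
    (htn : t none = s u) (htn' : t' none = s' u) :
    leZ t t' ↔ leT s s' := by
  have vac : ∀ (r : E → Bool) (b : Bool), (∀ d ∈ down u, r d = b) := fun r b d hd => (hu d hd).elim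
  have HS := forall_downZ_some down downZ hdZs
  have HN := forall_downZ_none downZ u hdZn
  rw [hleT, hleZ]
  constructor
  · rintro ⟨h1, h2, h3⟩
    refine ⟨fun e => ?_, fun e => ?_, fun e => ?_⟩
    · have h := h1 (some e); simp only [HS, hts, hts'] at h; exact h
    · have h := h2 (some e); simp only [HS, hts, hts'] at h; exact h
    · have h := h3 (some e); simp only [HS, hts, hts'] at h; exact h
  · rintro ⟨h1, h2, h3⟩
    refine ⟨fun o => ?_, fun o => ?_, fun o => ?_⟩
    · cases o with
      | none =>
        simp only [HN, htn, htn', hts, hts']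
        rintro ⟨ha, -⟩
        exact ⟨(h1 u ⟨ha, vac s' true⟩).1, (h1 u ⟨ha, vac s' true⟩).1⟩
      | some e => simp only [HS, hts, hts']; exact h1 e
    · cases o with
      | none =>
        simp only [HN, htn, htn', hts, hts']
        rintro ⟨ha, -⟩
        exact ⟨(h2 u ⟨ha, vac s false⟩).1, (h2 u ⟨ha, vac s false⟩).1⟩
      | some e => simp only [HS, hts, hts']; exact h2 e
    · cases o with
      | none =>
        simp only [HN, htn, htn', hts, hts']
        intro ha hb
        exact ⟨ha, hb⟩
      | some e => simp only [HS, hts, hts']; exact h3 e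

/-- **LEMMA A/D (antidiagonal).**  On colourings of `Q + hat(u)` with `z` coloured unlike `u`, the explicit colouring order is again the order of the
restrictions to `Q` (the antidiagonal is a second isomorphic copy of `TQ`). [this work] -/
theorem off_iff (down : E → Finset E) (u : E) (hu : ∀ d, d ∉ down u)
    (downZ : Option E → Finset (Option E)) (hdZn : ∀ o, o ∈ downZ none ↔ o = some u)
    (hdZs : ∀ e o, o ∈ downZ (some e) ↔ ∃ d ∈ down e, o = some d)
    (leT : (E → Bool) → (E → Bool) → Prop)
    (hleT : ∀ s t, leT s t ↔
      ((∀ e, (t e = true ∧ ∀ d ∈ down e, t d = true) → (s e = true ∧ ∀ d ∈ down e, s d = true)) ∧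
       (∀ e, (s e = false ∧ ∀ d ∈ down e, s d = false) → (t e = false ∧ ∀ d ∈ down e, t d = false)) ∧
       (∀ e, s e = true → t e = false → ((∀ d ∈ down e, s d = true) ∧ (∀ d ∈ down e, t d = false)))))
    (leZ : (Option E → Bool) → (Option E → Bool) → Prop)
    (hleZ : ∀ s t, leZ s t ↔
      ((∀ o, (t o = true ∧ ∀ d ∈ downZ o, t d = true) → (s o = true ∧ ∀ d ∈ downZ o, s d = true)) ∧
       (∀ o, (s o = false ∧ ∀ d ∈ downZ o, s d = false) → (t o = false ∧ ∀ d ∈ downZ o, t d = false)) ∧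
       (∀ o, s o = true → t o = false → ((∀ d ∈ downZ o, s d = true) ∧ (∀ d ∈ downZ o, t d = false)))))
    (s s' : E → Bool) (t t' : Option E → Bool) (hts : ∀ e, t (some e) = s e) (hts' : ∀ e, t' (some e) = s' e)
    (htn : t none = !(s u)) (htn' : t' none = !(s' u)) :
    leZ t t' ↔ leT s s' := by
  have vac : ∀ (r : E → Bool) (b : Bool), (∀ d ∈ down u, r d = b) := fun r b d hd => (hu d hd).elim
  have HS := forall_downZ_some down downZ hdZs
  have HN := forall_downZ_none downZ u hdZn
  rw [hleT, hleZ]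
  constructor
  · rintro ⟨h1, h2, h3⟩
    refine ⟨fun e => ?_, fun e => ?_, fun e => ?_⟩
    · have h := h1 (some e); simp only [HS, hts, hts'] at h; exact h
    · have h := h2 (some e); simp only [HS, hts, hts'] at h; exact h
    · have h := h3 (some e); simp only [HS, hts, hts'] at h; exact h
  · rintro ⟨h1, h2, h3⟩
    refine ⟨fun o => ?_, fun o => ?_, fun o => ?_⟩
    · cases o with
      | none =>
        simp only [HN, htn, htn', hts, hts']
        rintro ⟨ha, hb⟩
        rw [hb] at ha
        exact absurd ha (by decide)
      | some e => simp only [HS, hts, hts']; exact h1 e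
    · cases o with
      | none =>
        simp only [HN, htn, htn', hts, hts']
        rintro ⟨ha, hb⟩
        rw [hb] at ha
        exact absurd ha (by decide)
      | some e => simp only [HS, hts, hts']; exact h2 e
    · cases o with
      | none =>
        simp only [HN, htn, htn', hts, hts']
        intro ha hb
        -- `u` blue in `s` and red in `s'` contradicts condition (2) of `leT` at the atom `u`
        have hsu : s u = false := by simpa using ha
        have hs'u : s' u = true := by simpa using hb
        have h22 := (h2 u ⟨hsu, vac s false⟩).1
        rw [h22] at hs'u
        exact absurd hs'u (by decide)
      | some e => simp only [HS, hts, hts']; exact h3 e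

/-- Restriction to `Q` is monotone: `leZ t t' → leT (t ∘ some) (t' ∘ some)` (forgetting the maximal element `z`). [this work] -/
theorem restrict_mono (down : E → Finset E)
    (downZ : Option E → Finset (Option E)) (hdZs : ∀ e o, o ∈ downZ (some e) ↔ ∃ d ∈ down e, o = some d)
    (leT : (E → Bool) → (E → Bool) → Prop)
    (hleT : ∀ s t, leT s t ↔
      ((∀ e, (t e = true ∧ ∀ d ∈ down e, t d = true) → (s e = true ∧ ∀ d ∈ down e, s d = true)) ∧
       (∀ e, (s e = false ∧ ∀ d ∈ down e, s d = false) → (t e = false ∧ ∀ d ∈ down e, t d = false)) ∧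
       (∀ e, s e = true → t e = false → ((∀ d ∈ down e, s d = true) ∧ (∀ d ∈ down e, t d = false)))))
    (leZ : (Option E → Bool) → (Option E → Bool) → Prop)
    (hleZ : ∀ s t, leZ s t ↔
      ((∀ o, (t o = true ∧ ∀ d ∈ downZ o, t d = true) → (s o = true ∧ ∀ d ∈ downZ o, s d = true)) ∧
       (∀ o, (s o = false ∧ ∀ d ∈ downZ o, s d = false) → (t o = false ∧ ∀ d ∈ downZ o, t d = false)) ∧
       (∀ o, s o = true → t o = false → ((∀ d ∈ downZ o, s d = true) ∧ (∀ d ∈ downZ o, t d = false)))))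
    (t t' : Option E → Bool) (h : leZ t t') :
    leT (fun e => t (some e)) (fun e => t' (some e)) := by
  have HS := forall_downZ_some down downZ hdZs
  rw [hleZ] at h
  rw [hleT]
  obtain ⟨h1, h2, h3⟩ := h
  refine ⟨fun e => ?_, fun e => ?_, fun e => ?_⟩
  · have h := h1 (some e); simp only [HS] at h; exact h
  · have h := h2 (some e); simp only [HS] at h; exact h
  · have h := h3 (some e); simp only [HS] at h; exact h

/-- **HAT NEUTRALITY (THEOREM HAT of FINDING-STALK-g54 §3), kernel-complete at the colouring level.**  `Q` any finite poset given by strict down-sets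
`down` on the ground set `E` of `Q ∪ₐ wedge` (wedge atom `c = c′`, top `x = x′`), `u` an atom of `Q` (`↓°u = ∅`, `u ≠ c′, x′`), `z = none` the new
maximal element over `u` (`↓°z = {u}`); `leT`, `leZ` the explicit colouring orders of `TQ = Ω_{Q ∪ₐ wedge}` and `TQ′ = Ω_{(Q + hat(u)) ∪ₐ wedge}`, `ι′`, `κ`
their wedge flips.  If the rearrangement functional satisfies `R_T(A,B) ≥ m` for all pairs of `leT`-up-sets, then `R_Z(𝐀,𝐁) ≥ 2m` for all pairs of
`leZ`-up-sets.  With `m = 0`: **(R)(Q,a) ⟹ (R)(Q + hat(u), a)**; with `m = min R_T` and `hat_lift`: `min R_Z = 2·min R_T`.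
PROOF: `R_Z = R over the diagonal {z ≡ u} + R over the antidiagonal` (`AntitheticStalkSplit.R_split`, the diagonal is `κ`-stable since `u ∉ {c′,x′}`);
each half is an isomorphic copy of `TQ` (`diag_iff`, `off_iff`) on which the restricted up-sets pull back to `leT`-up-sets and `κ` pulls back to `ι′`
(`AntitheticStalkSplit.R_diag_eq`). [this work] -/
theorem hat_neutrality [Fintype E] [DecidableEq E] (down : E → Finset E) (u c x : E) (hu : ∀ d, d ∉ down u)
    (huc : u ≠ c) (hux : u ≠ x)
    (downZ : Option E → Finset (Option E)) (hdZn : ∀ o, o ∈ downZ none ↔ o = some u)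
    (hdZs : ∀ e o, o ∈ downZ (some e) ↔ ∃ d ∈ down e, o = some d)
    (leT : (E → Bool) → (E → Bool) → Prop)
    (hleT : ∀ s t, leT s t ↔
      ((∀ e, (t e = true ∧ ∀ d ∈ down e, t d = true) → (s e = true ∧ ∀ d ∈ down e, s d = true)) ∧
       (∀ e, (s e = false ∧ ∀ d ∈ down e, s d = false) → (t e = false ∧ ∀ d ∈ down e, t d = false)) ∧
       (∀ e, s e = true → t e = false → ((∀ d ∈ down e, s d = true) ∧ (∀ d ∈ down e, t d = false)))))
    (leZ : (Option E → Bool) → (Option E → Bool) → Prop)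
    (hleZ : ∀ s t, leZ s t ↔
      ((∀ o, (t o = true ∧ ∀ d ∈ downZ o, t d = true) → (s o = true ∧ ∀ d ∈ downZ o, s d = true)) ∧
       (∀ o, (s o = false ∧ ∀ d ∈ downZ o, s d = false) → (t o = false ∧ ∀ d ∈ downZ o, t d = false)) ∧
       (∀ o, s o = true → t o = false → ((∀ d ∈ downZ o, s d = true) ∧ (∀ d ∈ downZ o, t d = false)))))
    (ι' : (E → Bool) → (E → Bool))
    (hι : ∀ s e, ι' s e = (if s c = s x then !(s e) else (if e = c ∨ e = x then !(s e) else s e)))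
    (κ : (Option E → Bool) → (Option E → Bool))
    (hκ : ∀ t o, κ t o = (if t (some c) = t (some x) then !(t o) else (if o = some c ∨ o = some x then !(t o) else t o)))
    (m : ℤ)
    (hR : ∀ A B : Finset (E → Bool), (∀ s s', leT s s' → s ∈ A → s' ∈ A) → (∀ s s', leT s s' → s ∈ B → s' ∈ B) →
      m ≤ ((A ∩ B).card : ℤ) - ((A.filter (fun s => ι' s ∈ B)).card : ℤ))
    (AA BB : Finset (Option E → Bool)) (hAA : ∀ t t', leZ t t' → t ∈ AA → t' ∈ AA) (hBB : ∀ t t', leZ t t' → t ∈ BB → t' ∈ BB) :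
    2 * m ≤ ((AA ∩ BB).card : ℤ) - ((AA.filter (fun z => κ z ∈ BB)).card : ℤ) := by
  classical
  -- the two embeddings `δ` (diagonal: `z` coloured like `u`) and `δ'` (antidiagonal) and the diagonal `D`
  set δ : (E → Bool) → (Option E → Bool) := fun s o => Option.elim o (s u) s
  set δ' : (E → Bool) → (Option E → Bool) := fun s o => Option.elim o (!(s u)) s
  set D : Finset (Option E → Bool) := Finset.univ.filter (fun t => t none = t (some u))
  have δsome : ∀ s e, δ s (some e) = s e := fun s e => rfl
  have δnone : ∀ s, δ s none = s u := fun s => rfl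
  have δ'some : ∀ s e, δ' s (some e) = s e := fun s e => rfl
  have δ'none : ∀ s, δ' s none = !(s u) := fun s => rfl
  have hDmem : ∀ t, t ∈ D ↔ t none = t (some u) := fun t => by simp [D]
  have hDcmem : ∀ t, t ∈ univ \ D ↔ t none = !(t (some u)) := by
    intro t; rw [Finset.mem_sdiff, hDmem]; simp only [Finset.mem_univ, true_and]
    cases t none <;> cases t (some u) <;> decide
  have hδ : Function.Injective δ := by
    intro s s' h; funext e; have h1 := congrFun h (some e); rwa [δsome, δsome] at h1
  have hδ' : Function.Injective δ' := by
    intro s s' h; funext e; have h1 := congrFun h (some e); rwa [δ'some, δ'some] at h1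
  have h1 : ((none : Option E) = some c ∨ (none : Option E) = some x) ↔ False := by simp
  have h2 : (u = c ∨ u = x) ↔ False := by simp [huc, hux]
  have hκδ : ∀ s, κ (δ s) = δ (ι' s) := by
    intro s; funext o
    cases o with
    | none =>
      show κ (δ s) none = ι' s u
      rw [hκ, hι]
      simp only [δsome, δnone, h1, h2, if_false]
    | some e =>
      show κ (δ s) (some e) = ι' s e
      rw [hκ, hι]
      simp only [δsome, Option.some.injEq]
  have hκδ' : ∀ s, κ (δ' s) = δ' (ι' s) := by
    intro s; funext o
    cases o with
    | none =>
      show κ (δ' s) none = !(ι' s u)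
      rw [hκ, hι]
      simp only [δ'some, δ'none, h1, h2, if_false, Bool.not_not]
      split_ifs <;> simp
    | some e =>
      show κ (δ' s) (some e) = ι' s e
      rw [hκ, hι]
      simp only [δ'some, Option.some.injEq]
  have hD : ∀ t, t ∈ D ↔ κ t ∈ D := by
    intro t; rw [hDmem, hDmem, hκ, hκ]
    have h1 : ¬ ((none : Option E) = some c ∨ (none : Option E) = some x) := by simp
    have h2 : ¬ (some u = some c ∨ some u = some x) := by simp [huc, hux]
    simp only [h1, h2, if_false]
    split_ifs
    · constructor
      · intro h; rw [h]
      · intro h; exact Bool.not_inj h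
    · exact Iff.rfl
  have hDδ : ∀ s, δ s ∈ D := fun s => by rw [hDmem, δnone, δsome]
  have hDsurj : ∀ t ∈ D, ∃ s, δ s = t := by
    intro t ht; refine ⟨fun e => t (some e), ?_⟩; funext o
    cases o with
    | none => show t (some u) = t none; exact ((hDmem t).1 ht).symm
    | some e => rfl
  have hD'δ' : ∀ s, δ' s ∈ univ \ D := fun s => by rw [hDcmem, δ'none, δ'some]
  have hD'surj : ∀ t ∈ univ \ D, ∃ s, δ' s = t := by
    intro t ht; refine ⟨fun e => t (some e), ?_⟩; funext o
    cases o with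
    | none => show (!(t (some u))) = t none; exact ((hDcmem t).1 ht).symm
    | some e => rfl
  -- the pulled-back sets are `leT`-up-sets
  have DI := fun s s' => diag_iff down u hu downZ hdZn hdZs leT hleT leZ hleZ s s' (δ s) (δ s') (δsome s) (δsome s') (δnone s) (δnone s')
  have OI := fun s s' => off_iff down u hu downZ hdZn hdZs leT hleT leZ hleZ s s' (δ' s) (δ' s') (δ'some s) (δ'some s') (δ'none s) (δ'none s')
  have upA : ∀ s s', leT s s' → s ∈ univ.filter (fun s => δ s ∈ AA) → s' ∈ univ.filter (fun s => δ s ∈ AA) := by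
    intro s s' hss' hs; simp only [Finset.mem_filter, Finset.mem_univ, true_and] at hs ⊢
    exact hAA _ _ ((DI s s').2 hss') hs
  have upB : ∀ s s', leT s s' → s ∈ univ.filter (fun s => δ s ∈ BB) → s' ∈ univ.filter (fun s => δ s ∈ BB) := by
    intro s s' hss' hs; simp only [Finset.mem_filter, Finset.mem_univ, true_and] at hs ⊢
    exact hBB _ _ ((DI s s').2 hss') hs
  have upA' : ∀ s s', leT s s' → s ∈ univ.filter (fun s => δ' s ∈ AA) → s' ∈ univ.filter (fun s => δ' s ∈ AA) := by
    intro s s' hss' hs; simp only [Finset.mem_filter, Finset.mem_univ, true_and] at hs ⊢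
    exact hAA _ _ ((OI s s').2 hss') hs
  have upB' : ∀ s s', leT s s' → s ∈ univ.filter (fun s => δ' s ∈ BB) → s' ∈ univ.filter (fun s => δ' s ∈ BB) := by
    intro s s' hss' hs; simp only [Finset.mem_filter, Finset.mem_univ, true_and] at hs ⊢
    exact hBB _ _ ((OI s s').2 hss') hs
  -- assembly: split over `D ⊔ Dᶜ`, each part is a pulled-back `R_T`
  have eA : AA \ D = AA ∩ (univ \ D) := by
    ext t; simp only [Finset.mem_sdiff, Finset.mem_inter, Finset.mem_univ, true_and]
  have eB : BB \ D = BB ∩ (univ \ D) := by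
    ext t; simp only [Finset.mem_sdiff, Finset.mem_inter, Finset.mem_univ, true_and]
  have hdiag := AntitheticStalkSplit.R_diag_eq δ hδ ι' κ hκδ D hDδ hDsurj AA BB
  have hoff := AntitheticStalkSplit.R_diag_eq δ' hδ' ι' κ hκδ' (univ \ D) hD'δ' hD'surj AA BB
  have h1 := hR _ _ upA upB
  have h2 := hR _ _ upA' upB'
  rw [AntitheticStalkSplit.R_split κ D hD AA BB, eA, eB, hdiag, hoff]
  linarith

/-- Cardinality of a preimage under restriction: every colouring of `Q` has exactly two extensions to `Q + z`. [this work] -/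
theorem card_restrict_preimage [Fintype E] [DecidableEq E] (S : Finset (E → Bool)) :
    (Finset.univ.filter (fun t : Option E → Bool => (fun e => t (some e)) ∈ S)).card = 2 * S.card := by
  classical
  have himg : Finset.univ.filter (fun t : Option E → Bool => (fun e => t (some e)) ∈ S)
      = (Finset.univ ×ˢ S).image (fun p : Bool × (E → Bool) => fun o => Option.elim o p.1 p.2) := by
    ext t
    simp only [Finset.mem_filter, Finset.mem_univ, true_and, Finset.mem_image, Finset.mem_product]
    constructor
    · intro ht
      refine ⟨(t none, fun e => t (some e)), ht, ?_⟩
      funext o; cases o <;> rfl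
    · rintro ⟨p, hp, rfl⟩
      exact hp
  have hinj : Function.Injective (fun p : Bool × (E → Bool) => fun o : Option E => Option.elim o p.1 p.2) := by
    rintro ⟨b, s⟩ ⟨b', s'⟩ h
    have hn := congrFun h none
    have hs : s = s' := by funext e; exact congrFun h (some e)
    simp only [Option.elim] at hn
    rw [hn, hs]
  rw [himg, Finset.card_image_of_injective _ hinj, Finset.card_product, Finset.card_univ, Fintype.card_bool]

/-- **HAT LIFT (failures persist with doubled deficit).**  For `leT`-up-sets `𝐀, 𝐁` of `TQ` the preimages under restriction `t ↦ t ∘ some` are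
`leZ`-up-sets of `TQ′` and `R_Z(π⁻¹𝐀, π⁻¹𝐁) = 2·R_T(𝐀,𝐁)`.  With `hat_neutrality`: `min R_Z = 2·min R_T`, so `(R)(Q + hat(u), a) ⟺ (R)(Q,a)` and
hats on atoms DOUBLE the deficit of a failing base (memo §3c; e.g. `P6_33T = W@mid + hat(a)` has `min R = −2`). [this work] -/
theorem hat_lift [Fintype E] [DecidableEq E] (down : E → Finset E) (c x : E)
    (downZ : Option E → Finset (Option E)) (hdZs : ∀ e o, o ∈ downZ (some e) ↔ ∃ d ∈ down e, o = some d)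
    (leT : (E → Bool) → (E → Bool) → Prop)
    (hleT : ∀ s t, leT s t ↔
      ((∀ e, (t e = true ∧ ∀ d ∈ down e, t d = true) → (s e = true ∧ ∀ d ∈ down e, s d = true)) ∧
       (∀ e, (s e = false ∧ ∀ d ∈ down e, s d = false) → (t e = false ∧ ∀ d ∈ down e, t d = false)) ∧
       (∀ e, s e = true → t e = false → ((∀ d ∈ down e, s d = true) ∧ (∀ d ∈ down e, t d = false)))))
    (leZ : (Option E → Bool) → (Option E → Bool) → Prop)
    (hleZ : ∀ s t, leZ s t ↔
      ((∀ o, (t o = true ∧ ∀ d ∈ downZ o, t d = true) → (s o = true ∧ ∀ d ∈ downZ o, s d = true)) ∧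
       (∀ o, (s o = false ∧ ∀ d ∈ downZ o, s d = false) → (t o = false ∧ ∀ d ∈ downZ o, t d = false)) ∧
       (∀ o, s o = true → t o = false → ((∀ d ∈ downZ o, s d = true) ∧ (∀ d ∈ downZ o, t d = false)))))
    (ι' : (E → Bool) → (E → Bool))
    (hι : ∀ s e, ι' s e = (if s c = s x then !(s e) else (if e = c ∨ e = x then !(s e) else s e)))
    (κ : (Option E → Bool) → (Option E → Bool))
    (hκ : ∀ t o, κ t o = (if t (some c) = t (some x) then !(t o) else (if o = some c ∨ o = some x then !(t o) else t o)))
    (AA BB : Finset (E → Bool)) (hAA : ∀ s s', leT s s' → s ∈ AA → s' ∈ AA) (hBB : ∀ s s', leT s s' → s ∈ BB → s' ∈ BB) :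
    (∀ t t', leZ t t' → t ∈ Finset.univ.filter (fun t : Option E → Bool => (fun e => t (some e)) ∈ AA) →
        t' ∈ Finset.univ.filter (fun t : Option E → Bool => (fun e => t (some e)) ∈ AA)) ∧
    (∀ t t', leZ t t' → t ∈ Finset.univ.filter (fun t : Option E → Bool => (fun e => t (some e)) ∈ BB) →
        t' ∈ Finset.univ.filter (fun t : Option E → Bool => (fun e => t (some e)) ∈ BB)) ∧
    (((Finset.univ.filter (fun t : Option E → Bool => (fun e => t (some e)) ∈ AA) ∩
        Finset.univ.filter (fun t : Option E → Bool => (fun e => t (some e)) ∈ BB)).card : ℤ)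
      - (((Finset.univ.filter (fun t : Option E → Bool => (fun e => t (some e)) ∈ AA)).filter
          (fun z => κ z ∈ Finset.univ.filter (fun t : Option E → Bool => (fun e => t (some e)) ∈ BB))).card : ℤ)
      = 2 * (((AA ∩ BB).card : ℤ) - ((AA.filter (fun s => ι' s ∈ BB)).card : ℤ))) := by
  classical
  have mono := fun t t' (h : leZ t t') => restrict_mono down downZ hdZs leT hleT leZ hleZ t t' h
  refine ⟨?_, ?_, ?_⟩
  · intro t t' htt' ht; simp only [Finset.mem_filter, Finset.mem_univ, true_and] at ht ⊢
    exact hAA _ _ (mono t t' htt') ht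
  · intro t t' htt' ht; simp only [Finset.mem_filter, Finset.mem_univ, true_and] at ht ⊢
    exact hBB _ _ (mono t t' htt') ht
  · -- `κ` restricts to `ι'`
    have hκπ : ∀ t : Option E → Bool, (fun e => κ t (some e)) = ι' (fun e => t (some e)) := by
      intro t; funext e; rw [hκ, hι]; simp only [Option.some.injEq]
    have e1 : Finset.univ.filter (fun t : Option E → Bool => (fun e => t (some e)) ∈ AA) ∩
        Finset.univ.filter (fun t : Option E → Bool => (fun e => t (some e)) ∈ BB)
        = Finset.univ.filter (fun t : Option E → Bool => (fun e => t (some e)) ∈ AA ∩ BB) := by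
      ext t; simp only [Finset.mem_inter, Finset.mem_filter, Finset.mem_univ, true_and]
    have e2 : (Finset.univ.filter (fun t : Option E → Bool => (fun e => t (some e)) ∈ AA)).filter
          (fun z => κ z ∈ Finset.univ.filter (fun t : Option E → Bool => (fun e => t (some e)) ∈ BB))
        = Finset.univ.filter (fun t : Option E → Bool => (fun e => t (some e)) ∈ AA.filter (fun s => ι' s ∈ BB)) := by
      ext t; simp only [Finset.mem_filter, Finset.mem_univ, true_and, hκπ]
    rw [e1, e2, card_restrict_preimage, card_restrict_preimage]
    push_cast
    ring

end AntitheticHat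

end Summit.CriticalPhenomena.PercolationContinuityZ3.Theorems
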